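import Literature.Probability.Percolation.SiteCoveringBlocks
import HarnessLib

/-!
# Covering maps and SITE percolation, III: the lifted exploration upstairs
# (Lyons–Peres 2016, Thm. 6.47, site version; Gomes–Pereira–Sanchis 2026, Lemma 2)

Topic `Literature/Probability/Percolation`; bookkeeping definitions of one proof and their lemmas — no
new facts, no `sorry`. Third file of the site version of the covering theorem
(`SiteCoveringExploration.lean`, `SiteCoveringBlocks.lean`).

Upstairs (graph `G`, vertex map `φ : V → W` with the `m`-fold lifting property
`LyonsPeres647Multi.MultiLift`, start vertex `x₀` declared open) the exploration copies the one
downstairs: when the vertex `c` seen from the explored vertex `a` is examined downstairs — its `m`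
copies read one at a time — the `j`-th query upstairs reads the `j`-th lift of `c` adjacent to the lift of
`a` (`coinG`, `stratGm`); when the block completes with an open lift, `c` is lifted to it (`lamM`, the
lift table, `LyonsPeres647Multi.pick`). This is Gomes–Pereira–Sanchis' `x(g)` ("if `A(x(g), u)` occurs
… `x(g + u) = v`", §4.3 proof of Lemma 2) and Lyons–Peres' choice of `e_{k+1}` over `e'_{n_{k+1}}`.

* `φ_lamM` — the lift table lifts (`φ ∘ lamM = id` on the explored set);
* `stratGm_freshAlong` — no vertex of `G` is read twice: a coin read lies over an examined vertex or is
  an earlier (distinct) lift of the vertex being examined;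
* `shape_next_eq_m` — both strategies ask one coin per step, or both stop;
* `reachable_lamM_run`, `exists_finset_of_card_le_m` — the explored vertices lift injectively into the
  open site cluster of `x₀` (in the configuration `insert x₀ c`).

## References

* [LyonsPeres2016] Lyons–Peres, *Probability on Trees and Networks*, CUP 2016, §6.9 Thm. 6.47, proof
  p. 317 ("the proof for site percolation being almost identical").
* [GomesPereiraSanchis2026] Gomes–Pereira–Sanchis, J. Appl. Probab. 63 (2026) 61–72, §4.3 proof of
  Lemma 2.
-/

noncomputable section

namespace Literature.Probability.Percolation

open MeasureTheory ProbabilityTheory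
open scoped ENNReal Classical

namespace LyonsPeres647Site

open LyonsPeres647 (run_succ_of_none run_succ_of_some answer_singleton)
open LyonsPeres647Multi (split split_nil split_cons_of_eq split_cons_of_ne length_split_snd_lt
  split_fst_cons pick liftFam liftFam_spec MultiLift)

variable {V W : Type*}

/-! ### Positions of `true` answers in a block -/

section Pick

variable {m : ℕ}

/-- `l.any id` holds iff some entry of `l.reverse` (the answers in reading order) is `true`.
[cite: MartineauSevero2019, §5 ("(∨_k ω_{e,k})_e")] -/
theorem any_eq_true_iff_exists_getD (l : List Bool) :
    l.any id = true ↔ ∃ j : ℕ, j < l.length ∧ l.reverse.getD j false = true := by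
  have hrev : l.any id = l.reverse.any id := by simp
  rw [hrev, List.any_eq_true]
  constructor
  · rintro ⟨x, hx, h⟩
    obtain ⟨i, hi, rfl⟩ := List.mem_iff_getElem.1 hx
    refine ⟨i, by simpa using hi, ?_⟩
    rw [List.getD_eq_getElem?_getD, List.getElem?_eq_getElem hi]
    simpa using h
  · rintro ⟨i, hi, h⟩
    have hi' : i < l.reverse.length := by simpa using hi
    refine ⟨_, List.getElem_mem hi', ?_⟩
    rw [List.getD_eq_getElem?_getD, List.getElem?_eq_getElem hi'] at h
    simpa using h

/-- `pick` returns a position whose answer was `true`. [cite: LyonsPeres2016, §6.9 proof of Thm. 6.47 (the open lift edge)] -/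
theorem pick_spec {l : List Bool} {j : Fin m} (h : pick m l = some j) : l.reverse.getD j false = true := by
  unfold pick at h
  split_ifs at h with h'
  cases h
  exact h'.choose_spec

/-- For a complete block (`m` answers), `pick` fails iff no answer was `true`.
[cite: LyonsPeres2016, §6.9 proof of Thm. 6.47 (the open lift edge)] -/
theorem pick_eq_none_iff {l : List Bool} (hl : l.length = m) : pick m l = none ↔ l.any id = false := by
  rw [← Bool.not_eq_true, any_eq_true_iff_exists_getD]
  unfold pick
  split_ifs with h
  · simp only [false_iff, not_not]
    obtain ⟨j, hj⟩ := h
    exact ⟨j, hl ▸ j.isLt, hj⟩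
  · simp only [true_iff]
    rintro ⟨i, hi, h'⟩
    exact h ⟨⟨i, hl ▸ hi⟩, h'⟩

/-- Answers in reading order: appending the newest answer. [cite: MartineauSevero2019, §5 (Step 2K+1)] -/
theorem reverse_cons_getD_of_lt {a : Bool} {l : List Bool} {j : ℕ} (hj : j < l.length) :
    (a :: l).reverse.getD j false = l.reverse.getD j false := by
  rw [List.reverse_cons, List.getD_eq_getElem?_getD, List.getD_eq_getElem?_getD,
    List.getElem?_append_left (by simpa using hj)]

/-- Answers in reading order: the newest answer sits at position `l.length`.
[cite: MartineauSevero2019, §5 (Step 2K+1)] -/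
theorem reverse_cons_getD_length (a : Bool) (l : List Bool) :
    (a :: l).reverse.getD l.length false = a := by
  rw [List.reverse_cons, List.getD_eq_getElem?_getD,
    List.getElem?_append_right (by simp)]
  simp

end Pick

/-! ### The lift table -/

section Lift

variable (G : SimpleGraph V) (H : SimpleGraph W) (φ : V → W) (ι : W → ℕ) (x₀ : V) (m : ℕ)

/-- **The lift table** after a transcript (read in blocks of `m`): initially everything lifts to `x₀`;
when the block of the examined vertex `c` (seen from `a`) completes with some open lift, `c` is lifted
to the corresponding lift of `c` adjacent to the lift of `a`.
[cite: GomesPereiraSanchis2026, §4.3 proof of Lemma 2 (x(g + u) = v)] -/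
def lamM : List Bool → W → V
  | [] => fun _ => x₀
  | a :: b =>
    match nextPair H ι (stateOf H ι (φ x₀) (split m b).1) with
    | none => lamM b
    | some q =>
      if (split m b).2.length + 1 = m then
        match pick m (a :: (split m b).2) with
        | none => lamM b
        | some j => Function.update (lamM b) q.2 (liftFam G φ m (lamM b q.1) q.2 j)
      else lamM b

variable {G H φ ι x₀ m}

/-- Replay of the lift table after a stop. [cite: GomesPereiraSanchis2026, §4.3 proof of Lemma 2] -/
theorem lamM_cons_of_none {a : Bool} {b : List Bool}
    (h : nextPair H ι (stateOf H ι (φ x₀) (split m b).1) = none) :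
    lamM G H φ ι x₀ m (a :: b) = lamM G H φ ι x₀ m b := by
  simp only [lamM, h]

/-- Replay of the lift table inside a block. [cite: GomesPereiraSanchis2026, §4.3 proof of Lemma 2] -/
theorem lamM_cons_of_ne {a : Bool} {b : List Bool} {q : W × W}
    (h : nextPair H ι (stateOf H ι (φ x₀) (split m b).1) = some q) (hne : (split m b).2.length + 1 ≠ m) :
    lamM G H φ ι x₀ m (a :: b) = lamM G H φ ι x₀ m b := by
  simp only [lamM, h, hne, if_false]

/-- Replay of the lift table when a block completes. [cite: GomesPereiraSanchis2026, §4.3 proof of Lemma 2] -/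
theorem lamM_cons_of_eq {a : Bool} {b : List Bool} {q : W × W}
    (h : nextPair H ι (stateOf H ι (φ x₀) (split m b).1) = some q) (heq : (split m b).2.length + 1 = m) :
    lamM G H φ ι x₀ m (a :: b) = match pick m (a :: (split m b).2) with
      | none => lamM G H φ ι x₀ m b
      | some j => Function.update (lamM G H φ ι x₀ m b) q.2 (liftFam G φ m (lamM G H φ ι x₀ m b q.1) q.2 j) := by
  simp only [lamM, h, heq, if_true]

/-- The macro-state is unchanged by an answer that does not complete a block.
[cite: MartineauSevero2019, §5 (Step 2K+1)] -/
theorem stateOf_split_cons_of_ne {o : W} {a : Bool} {b : List Bool} (hne : (split m b).2.length + 1 ≠ m) :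
    stateOf H ι o (split m (a :: b)).1 = stateOf H ι o (split m b).1 := by
  rw [split_cons_of_ne hne]

/-- The macro-state after a completed block is one step of the exploration.
[cite: MartineauSevero2019, §5 (Step 2K+1)] -/
theorem stateOf_split_cons_of_eq {o : W} {a : Bool} {b : List Bool} {q : W × W}
    (h : nextPair H ι (stateOf H ι o (split m b).1) = some q) (heq : (split m b).2.length + 1 = m) :
    stateOf H ι o (split m (a :: b)).1 = xstep (stateOf H ι o (split m b).1) q ((a :: (split m b).2).any id) := by
  rw [split_cons_of_eq heq, stateOf_cons_of_some h]

/-- The macro-state is unchanged by any answer after a stop. [cite: MartineauSevero2019, §5 (Step 2K+1)] -/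
theorem stateOf_split_cons_of_none {o : W} {a : Bool} {b : List Bool}
    (h : nextPair H ι (stateOf H ι o (split m b).1) = none) :
    stateOf H ι o (split m (a :: b)).1 = stateOf H ι o (split m b).1 := by
  rcases split_fst_cons (m := m) a b with h1 | ⟨a', h1⟩
  · rw [h1]
  · rw [h1, stateOf_cons_of_none h]

/-- **The lift table lifts**: `φ (lamM b w) = w` for every explored vertex `w`.
[cite: LyonsPeres2016, §6.9 proof of Thm. 6.47 ("edges e_j that φ maps onto e'_{n_j}")] -/
theorem φ_lamM (hφ : MultiLift G H φ m) (b : List Bool) :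
    ∀ w ∈ (stateOf H ι (φ x₀) (split m b).1).A, φ (lamM G H φ ι x₀ m b w) = w := by
  induction b with
  | nil => intro w hw; simp only [split_nil, stateOf, Finset.mem_singleton] at hw; subst hw; rfl
  | cons a b ih =>
    intro w hw
    cases h : nextPair H ι (stateOf H ι (φ x₀) (split m b).1) with
    | none =>
      rw [lamM_cons_of_none h]
      rw [stateOf_split_cons_of_none h] at hw
      exact ih w hw
    | some q =>
      have hq := nextPair_mem h
      by_cases hc : (split m b).2.length + 1 = m
      · rw [stateOf_split_cons_of_eq h hc] at hw
        rw [lamM_cons_of_eq h hc]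
        cases hp : pick m (a :: (split m b).2) with
        | none =>
          have hany : (a :: (split m b).2).any id = false :=
            (pick_eq_none_iff (by simp [hc])).1 hp
          simp only [xstep, hany, Bool.false_eq_true, if_false] at hw
          exact ih w hw
        | some j =>
          simp only
          rcases eq_or_ne w q.2 with rfl | hne
          · rw [Function.update_self]
            have h1 : φ (lamM G H φ ι x₀ m b q.1) = q.1 := ih q.1 hq.1
            have hadj : H.Adj (φ (lamM G H φ ι x₀ m b q.1)) q.2 := by rw [h1]; exact hq.2.2.1
            exact ((liftFam_spec hφ hadj).1 j).2
          · rw [Function.update_of_ne hne]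
            have hw' : w ∈ (stateOf H ι (φ x₀) (split m b).1).A := by
              by_cases hany : (a :: (split m b).2).any id = true
              · simp only [xstep, hany, if_true, Finset.mem_insert] at hw
                exact hw.resolve_left hne
              · simp only [xstep, hany] at hw
                exact hw
            exact ih w hw'
      · rw [stateOf_split_cons_of_ne hc] at hw
        rw [lamM_cons_of_ne h hc]
        exact ih w hw

end Lift

/-! ### The lifted exploration upstairs -/

section Strat

variable (G : SimpleGraph V) (H : SimpleGraph W) (φ : V → W) (ι : W → ℕ) (x₀ : V) (m : ℕ) [NeZero m]

/-- The coin read upstairs after the transcript `b` when the vertex `c = q.2` (seen from `a = q.1`) is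
being examined downstairs: the `j`-th lift of `c` adjacent to the lift of `a`, `j` = the number of
copies already read. [cite: GomesPereiraSanchis2026, §4.3 proof of Lemma 2 (the event A(x(g), u))] -/
def coinG (b : List Bool) (q : W × W) : V :=
  liftFam G φ m (lamM G H φ ι x₀ m b q.1) q.2 (Fin.ofNat m (split m b).2.length)

/-- The exploration upstairs as a one-coin strategy on the vertices of `V`.
[cite: LyonsPeres2016, §6.9 proof of Thm. 6.47 ("Set ω(e_{k+1}) := ω'(e'_{n_{k+1}})")] -/
def stratGm : CoinStrategy V :=
  ⟨fun b => (nextPair H ι (stateOf H ι (φ x₀) (split m b).1)).map fun q =>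
    ⟨{coinG G H φ ι x₀ m b q}, true⟩⟩

variable {G H φ ι x₀ m}

/-- The coin read upstairs lies over the examined vertex. [cite: GomesPereiraSanchis2026, §4.3 proof of Lemma 2] -/
theorem map_coinG (hφ : MultiLift G H φ m) {b : List Bool} {q : W × W}
    (h : nextPair H ι (stateOf H ι (φ x₀) (split m b).1) = some q) :
    φ (coinG G H φ ι x₀ m b q) = q.2 := by
  have hq := nextPair_mem h
  have h1 : φ (lamM G H φ ι x₀ m b q.1) = q.1 := φ_lamM hφ b q.1 hq.1
  have hadj : H.Adj (φ (lamM G H φ ι x₀ m b q.1)) q.2 := by rw [h1]; exact hq.2.2.1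
  exact ((liftFam_spec hφ hadj).1 _).2

/-- The next query upstairs. [cite: LyonsPeres2016, §6.9 proof of Thm. 6.47 (site version)] -/
theorem stratGm_next (b : List Bool) :
    (stratGm G H φ ι x₀ m).next b = (nextPair H ι (stateOf H ι (φ x₀) (split m b).1)).map fun q =>
      ⟨{coinG G H φ ι x₀ m b q}, true⟩ := rfl

/-- **The coins read upstairs** lie over examined vertices, or are the lifts already tried in the current
block. [cite: LyonsPeres2016, §6.9 proof of Thm. 6.47 (site version)] -/
theorem used_stratGm_subset (hφ : MultiLift G H φ m) (b : List Bool) :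
    ∀ f ∈ (stratGm G H φ ι x₀ m).used b, φ f ∈ (stateOf H ι (φ x₀) (split m b).1).Q ∨
      ∃ q, nextPair H ι (stateOf H ι (φ x₀) (split m b).1) = some q ∧ ∃ j : Fin m,
        (j : ℕ) < (split m b).2.length ∧
        f = liftFam G φ m (lamM G H φ ι x₀ m b q.1) q.2 j := by
  induction b with
  | nil => simp [CoinStrategy.used]
  | cons a b ih =>
    intro f hf
    rw [CoinStrategy.used, stratGm_next] at hf
    have hlt : (split m b).2.length < m := length_split_snd_lt (NeZero.pos m) b
    cases h : nextPair H ι (stateOf H ι (φ x₀) (split m b).1) with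
    | none =>
      rw [h] at hf
      rcases ih f hf with h1 | ⟨q, hq, -⟩
      · rw [stateOf_split_cons_of_none h]; exact Or.inl h1
      · rw [h] at hq; exact absurd hq (by simp)
    | some q =>
      rw [h] at hf
      simp only [Option.map_some, Finset.mem_union, Finset.mem_singleton] at hf
      have hq := nextPair_mem h
      have hφv : φ (lamM G H φ ι x₀ m b q.1) = q.1 := φ_lamM hφ b q.1 hq.1
      have hadj : H.Adj (φ (lamM G H φ ι x₀ m b q.1)) q.2 := by rw [hφv]; exact hq.2.2.1
      -- every coin of the current block lies over `q.2`
      have hover : ∀ j : Fin m, φ (liftFam G φ m (lamM G H φ ι x₀ m b q.1) q.2 j) = q.2 := fun j =>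
        ((liftFam_spec hφ hadj).1 j).2
      by_cases hc : (split m b).2.length + 1 = m
      · -- the block completes: all its coins now lie over an examined vertex
        rw [stateOf_split_cons_of_eq h hc]
        have hQ : q.2 ∈ (xstep (stateOf H ι (φ x₀) (split m b).1) q ((a :: (split m b).2).any id)).Q :=
          Finset.mem_insert_self _ _
        rcases hf with rfl | hf
        · left; rw [coinG, hover]; exact hQ
        · rcases ih f hf with h1 | ⟨q', hq', j, -, rfl⟩
          · exact Or.inl (Finset.mem_insert_of_mem h1)
          · rw [h] at hq'; cases hq'
            left; rw [hover]; exact hQ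
      · rw [stateOf_split_cons_of_ne hc, lamM_cons_of_ne h hc, split_cons_of_ne hc]
        rcases hf with rfl | hf
        · refine Or.inr ⟨q, h, Fin.ofNat m (split m b).2.length, ?_, rfl⟩
          simp [Nat.mod_eq_of_lt hlt]
        · rcases ih f hf with h1 | ⟨q', hq', j, hj, rfl⟩
          · exact Or.inl h1
          · rw [h] at hq'; cases hq'
            refine Or.inr ⟨q, h, j, ?_, rfl⟩
            simp only [List.length_cons]; omega

/-- **No vertex is read twice upstairs**: the next coin lies over an unexamined vertex, and differs from
the earlier coins of its block because the `m` lifts are distinct.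
[cite: LyonsPeres2016, §6.9 proof of Thm. 6.47 (site version)] -/
theorem stratGm_freshAlong (hφ : MultiLift G H φ m) : (stratGm G H φ ι x₀ m).FreshAlong := by
  intro b Qy _ hQ
  rw [stratGm_next] at hQ
  have hlt : (split m b).2.length < m := length_split_snd_lt (NeZero.pos m) b
  cases h : nextPair H ι (stateOf H ι (φ x₀) (split m b).1) with
  | none => rw [h] at hQ; simp at hQ
  | some q =>
    rw [h] at hQ
    simp only [Option.map_some, Option.some.injEq] at hQ
    subst hQ
    simp only [Finset.disjoint_singleton_left]
    intro hmem
    rcases used_stratGm_subset hφ b _ hmem with hover | ⟨q', hq', j, hj, hf⟩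
    · rw [map_coinG hφ h] at hover
      exact (nextPair_mem h).2.2.2 hover
    · rw [h] at hq'; cases hq'
      have hq := nextPair_mem h
      have hφv : φ (lamM G H φ ι x₀ m b q.1) = q.1 := φ_lamM hφ b q.1 hq.1
      have hadj : H.Adj (φ (lamM G H φ ι x₀ m b q.1)) q.2 := by rw [hφv]; exact hq.2.2.1
      rw [coinG] at hf
      have hj' := congrArg Fin.val ((liftFam_spec hφ hadj).2 hf)
      simp [Nat.mod_eq_of_lt hlt] at hj'
      omega

/-- **Both explorations ask one coin per step, or both stop.** [cite: LyonsPeres2016, §6.9 proof of Thm. 6.47 (site version)] -/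
theorem shape_next_eq_m {o : W} (hx : φ x₀ = o) (b : List Bool) :
    ((stratHm H ι o m).next b).map CoinQuery.shape = ((stratGm G H φ ι x₀ m).next b).map CoinQuery.shape := by
  subst hx
  rw [stratHm_next, stratGm_next]
  cases nextPair H ι (stateOf H ι (φ x₀) (split m b).1) with
  | none => rfl
  | some q => simp [CoinQuery.shape]

/-! ### What the run upstairs explores -/

/-- **Upstairs, explored vertices lift into the open site cluster of `x₀`, and the answers of the
current block record which lifts are open**: along the run of the lifted strategy on the open vertices
`c` (with `x₀` declared open), every explored vertex `w` has its lift open and joined to `x₀` through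
open vertices of `G`, and a `true` answer at position `j` of the current block (vertex `c` seen from `a`
being examined) says that the `j`-th lift of `c` adjacent to the lift of `a` is open.
[cite: LyonsPeres2016, §6.9 proof of Thm. 6.47 ("then so is K(x)")] [cite: GomesPereiraSanchis2026, §4.3 proof of Lemma 2 ("|x(I)| = |I|")] -/
theorem reachable_lamM_run (hφ : MultiLift G H φ m) (c : Set V) (k : ℕ) :
    (∀ w ∈ (stateOf H ι (φ x₀) (split m ((stratGm G H φ ι x₀ m).run k c)).1).A,
      lamM G H φ ι x₀ m ((stratGm G H φ ι x₀ m).run k c) w ∈ insert x₀ c ∧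
      (siteOpenGraph G (insert x₀ c)).Reachable x₀
        (lamM G H φ ι x₀ m ((stratGm G H φ ι x₀ m).run k c) w)) ∧
    (∀ q, nextPair H ι (stateOf H ι (φ x₀) (split m ((stratGm G H φ ι x₀ m).run k c)).1) = some q →
      ∀ j : Fin m, (j : ℕ) < (split m ((stratGm G H φ ι x₀ m).run k c)).2.length →
        (split m ((stratGm G H φ ι x₀ m).run k c)).2.reverse.getD j false = true →
          liftFam G φ m (lamM G H φ ι x₀ m ((stratGm G H φ ι x₀ m).run k c) q.1) q.2 j ∈ c) := by
  induction k with
  | zero =>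
    refine ⟨?_, ?_⟩
    · intro w hw
      simp only [CoinStrategy.run_zero, split_nil, stateOf, Finset.mem_singleton] at hw ⊢
      subst hw
      exact ⟨Set.mem_insert _ _, SimpleGraph.Reachable.refl _⟩
    · intro q _ j hj
      simp at hj
  | succ k ih =>
    obtain ⟨ih1, ih2⟩ := ih
    set b := (stratGm G H φ ι x₀ m).run k c with hb
    have hlt : (split m b).2.length < m := length_split_snd_lt (NeZero.pos m) b
    cases h : nextPair H ι (stateOf H ι (φ x₀) (split m b).1) with
    | none =>
      have hn : (stratGm G H φ ι x₀ m).next b = none := by rw [stratGm_next, h]; rfl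
      rw [run_succ_of_none _ hn]
      exact ⟨ih1, ih2⟩
    | some q =>
      have hq := nextPair_mem h
      have hn : (stratGm G H φ ι x₀ m).next b = some ⟨{coinG G H φ ι x₀ m b q}, true⟩ := by
        rw [stratGm_next, h]; rfl
      rw [run_succ_of_some _ hn, answer_singleton]
      set a := decide (coinG G H φ ι x₀ m b q ∈ c) with ha
      set v := lamM G H φ ι x₀ m b q.1 with hv
      have hφv : φ v = q.1 := φ_lamM hφ b q.1 hq.1
      have hadj : H.Adj (φ v) q.2 := by rw [hφv]; exact hq.2.2.1
      -- the extended record of the current block, including the new answer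
      have hrec : ∀ j : Fin m, (j : ℕ) < (split m b).2.length + 1 →
          (a :: (split m b).2).reverse.getD j false = true → liftFam G φ m v q.2 j ∈ c := by
        intro j hj hbit
        rcases Nat.lt_succ_iff_lt_or_eq.1 hj with hj | hj
        · rw [reverse_cons_getD_of_lt hj] at hbit
          exact ih2 q h j hj hbit
        · rw [hj, reverse_cons_getD_length, ha, decide_eq_true_eq] at hbit
          have hjj : Fin.ofNat m (split m b).2.length = j := by
            ext; rw [← hj]; simp
          rw [coinG, hjj] at hbit
          exact hbit
      by_cases hc : (split m b).2.length + 1 = m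
      · -- the block completes
        refine ⟨?_, fun q' _ j hj => ?_⟩
        · intro w hw
          rw [stateOf_split_cons_of_eq h hc] at hw
          rw [lamM_cons_of_eq h hc]
          cases hp : pick m (a :: (split m b).2) with
          | none =>
            have hany : (a :: (split m b).2).any id = false := (pick_eq_none_iff (by simp [hc])).1 hp
            simp only [xstep, hany, Bool.false_eq_true, if_false] at hw
            exact ih1 w hw
          | some j =>
            simp only
            rcases eq_or_ne w q.2 with rfl | hne
            · rw [Function.update_self]
              have hopen : liftFam G φ m v q.2 j ∈ c := hrec j (hc.symm ▸ j.isLt) (pick_spec hp)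
              have hadjG : G.Adj v (liftFam G φ m v q.2 j) := ((liftFam_spec hφ hadj).1 j).1
              obtain ⟨hvo, hvr⟩ := ih1 q.1 hq.1
              refine ⟨Set.mem_insert_of_mem _ hopen, hvr.trans (SimpleGraph.Adj.reachable ?_)⟩
              rw [siteOpenGraph_adj]
              exact ⟨hadjG, hvo, Set.mem_insert_of_mem _ hopen⟩
            · rw [Function.update_of_ne hne]
              have hw' : w ∈ (stateOf H ι (φ x₀) (split m b).1).A := by
                by_cases hany : (a :: (split m b).2).any id = true
                · simp only [xstep, hany, if_true, Finset.mem_insert] at hw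
                  exact hw.resolve_left hne
                · simp only [xstep, hany] at hw
                  exact hw
              exact ih1 w hw'
        · rw [split_cons_of_eq hc] at hj
          simp at hj
      · -- inside the block
        rw [stateOf_split_cons_of_ne hc, lamM_cons_of_ne h hc, split_cons_of_ne hc]
        refine ⟨ih1, fun q' hq' j hj hbit => ?_⟩
        rw [h] at hq'; cases hq'
        exact hrec j (by simpa using hj) hbit

/-- **Upstairs, "`≥ n` vertices explored" forces `≥ n` vertices in the open site cluster of `x₀`** (the
lift table is injective on the explored set, `φ` being a left inverse).
[cite: GomesPereiraSanchis2026, §4.3 proof of Lemma 2 ("|x(I)| = |I|")] -/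
theorem exists_finset_of_card_le_m (hφ : MultiLift G H φ m) (c : Set V) (k n : ℕ)
    (hn : n ≤ (stateOf H ι (φ x₀) (split m ((stratGm G H φ ι x₀ m).run k c)).1).A.card) :
    ∃ S : Finset V, n ≤ S.card ∧ ∀ v ∈ S, v ∈ siteCluster G (insert x₀ c) x₀ := by
  set b := (stratGm G H φ ι x₀ m).run k c with hb
  refine ⟨(stateOf H ι (φ x₀) (split m b).1).A.image (lamM G H φ ι x₀ m b), ?_, ?_⟩
  · rw [Finset.card_image_of_injOn]
    · exact hn
    · intro w₁ hw₁ w₂ hw₂ heq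
      have h1 := φ_lamM hφ b w₁ hw₁
      have h2 := φ_lamM hφ b w₂ hw₂
      rw [← h1, ← h2]
      exact congrArg φ heq
  · intro v hv
    obtain ⟨w, hw, rfl⟩ := Finset.mem_image.1 hv
    obtain ⟨hwo, hwr⟩ := (reachable_lamM_run hφ c k).1 w hw
    exact ⟨Set.mem_insert _ _, hwo, hwr⟩

end Strat

end LyonsPeres647Site

end Literature.Probability.Percolation

end
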